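import Literature.NumberTheory.ComplexMultiplication.ArtinLiftAlgebra
import Literature.NumberTheory.EllipticCurves.TwistedHeegnerFamilyExistence
import HarnessLib

/-!
# Finite levels of `Aut(ℂ)` over number fields (the field `k₂` of Shimura 1998, §21.4, pp. 147–148)

Topic `FieldTheory/AlgClosed`.  Everything here is **proved**.  For number fields `k, k₁ ⊂ ℂ` and a
fixed `k₁`-embedding `e₁ : k̄₁ → ℂ` we collect the field theory behind Shimura's sentence «we can find a
finite Galois extension `k₂` of `k` containing `k₁` such that … for all `σ ∈ Gal(ℂ/k₂)`» (proof of
Thm. 21.4, pp. 147–148): an automorphism of `ℂ` fixing a primitive element of `k/ℚ` fixes `k`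
(`ringEquiv_apply_algebraMap_of_adjoin_eq_top`); every `g ∈ Gal(k̄₁/k₁)` fixing a preimage of that
primitive element extends along `e₁` to an automorphism of `ℂ` over `k₁` fixing `k`
(`exists_algEquiv_extends_of_mem_fixingSubgroup`); an open subgroup of `Gal(k̄₁/E₀)` contains a finite
level `Gal(k̄₁/E')` (`exists_intermediateField_fixingSubgroup_subset`, Krull topology); and a finite
level `E' ⊆ k̄₁` over `k₁` is contained in a finite Galois extension `k₂ ⊆ ℂ` of `k` containing `k₁`
(`exists_intermediateField_isGalois_forall_mem`: the normal closure over `k` of `k(θ₁, e₁(basis of E'))`).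

References: Lang, *Algebra*, Ch. V §4 (primitive elements), Ch. V §3 / VI §1 (normal closures, Galois
extensions); Neukirch, *Algebraic Number Theory*, Ch. IV §1 (Krull topology); Shimura 1998 §21.4.
-/

set_option autoImplicit false

noncomputable section

open scoped IntermediateField

namespace Literature.FieldTheory.AlgClosed

open Literature.NumberTheory.ComplexMultiplication (exists_algEquiv_apply_embedding_eq)

/-- Every algebraic complex number is in the image of any `k₁`-embedding `k̄₁ → ℂ` (`k₁` a number
field). [cite: Lang2002, Ch. V §2 Thm. 2.8 (consequence: algebraic elements lie in the image)] -/
theorem exists_apply_eq_of_isAlgebraic {k₁ : Type} [Field k₁] [NumberField k₁] [Algebra k₁ ℂ]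
    (e₁ : AlgebraicClosure k₁ →ₐ[k₁] ℂ) (z : ℂ) (hz : IsAlgebraic ℚ z) :
    ∃ x : AlgebraicClosure k₁, e₁ x = z :=
  Literature.NumberTheory.EllipticCurves.mem_range_of_isAlgebraic e₁ (hz.tower_top k₁)

/-- The image under a `k₁`-embedding `k̄₁ → ℂ` of any element of `k̄₁` is an algebraic number.
[cite: Lang2002, Ch. V §1 Prop. 1.4 (algebraic elements are preserved by homomorphisms)] -/
theorem isAlgebraic_apply {k₁ : Type} [Field k₁] [NumberField k₁] [Algebra k₁ ℂ]
    (e₁ : AlgebraicClosure k₁ →ₐ[k₁] ℂ) (x : AlgebraicClosure k₁) : IsAlgebraic ℚ (e₁ x) := by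
  haveI : Algebra.IsAlgebraic ℚ (AlgebraicClosure k₁) := Algebra.IsAlgebraic.trans ℚ k₁ (AlgebraicClosure k₁)
  have hx : IsIntegral ℚ x := (Algebra.IsAlgebraic.isAlgebraic (R := ℚ) x).isIntegral
  exact (hx.map e₁.toRingHom.toRatAlgHom).isAlgebraic

/-- An automorphism of `ℂ` fixing (the image of) a primitive element `θ` of the number field `k / ℚ`
fixes `k` pointwise (`k = ℚ(θ) = ℚ[θ]`). [cite: Lang2002, Ch. V §4 Thm. 4.6 (primitive element theorem) with Ch. V §1 (k = ℚ[θ])] -/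
theorem ringEquiv_apply_algebraMap_of_adjoin_eq_top {k : Type} [Field k] [NumberField k] [Algebra k ℂ]
    {θ : k} (hθ : ℚ⟮θ⟯ = ⊤) (s : ℂ ≃+* ℂ) (hs : s (algebraMap k ℂ θ) = algebraMap k ℂ θ) (a : k) :
    s (algebraMap k ℂ a) = algebraMap k ℂ a := by
  let f₁ : k →ₐ[ℚ] ℂ := (algebraMap k ℂ).toRatAlgHom
  let f₂ : k →ₐ[ℚ] ℂ := (s.toRingHom.comp (algebraMap k ℂ)).toRatAlgHom
  have hθmem : θ ∈ AlgHom.equalizer f₂ f₁ := by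
    rw [AlgHom.mem_equalizer]
    exact hs
  have htop : Algebra.adjoin ℚ {θ} = ⊤ := by
    rw [← IntermediateField.adjoin_simple_toSubalgebra_of_isAlgebraic (Algebra.IsAlgebraic.isAlgebraic θ), hθ,
      IntermediateField.top_toSubalgebra]
  have hle : Algebra.adjoin ℚ {θ} ≤ AlgHom.equalizer f₂ f₁ :=
    Algebra.adjoin_le (Set.singleton_subset_iff.2 hθmem)
  have ha : a ∈ AlgHom.equalizer f₂ f₁ := hle (htop ▸ Algebra.mem_top)
  rw [AlgHom.mem_equalizer] at ha
  exact ha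

/-- **Extension with control over `k`.**  Let `θ` be a primitive element of `k/ℚ` and `xθ ∈ k̄₁` with
`e₁ xθ = θ`.  Every `g ∈ Gal(k̄₁/k₁(xθ))` extends along `e₁` to an automorphism `s₁` of `ℂ` over `k₁`
(`exists_algEquiv_apply_embedding_eq`: `k̄₁` is countable, `ℂ` is algebraically closed of uncountable
transcendence degree), and any such `s₁` fixes `k` (it fixes `θ = e₁ xθ`).
[cite: Lang2002, Ch. V §2 Thm. 2.8; Ch. V §4 Thm. 4.6] [cite: Shimura1998, §21.4, proof of Thm. 21.4, pp. 147–148] -/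
theorem exists_algEquiv_extends_of_mem_fixingSubgroup {k : Type} [Field k] [NumberField k] [Algebra k ℂ]
    {k₁ : Type} [Field k₁] [NumberField k₁] [Algebra k₁ ℂ] (e₁ : AlgebraicClosure k₁ →ₐ[k₁] ℂ)
    {θ : k} (hθ : ℚ⟮θ⟯ = ⊤) {xθ : AlgebraicClosure k₁} (hxθ : e₁ xθ = algebraMap k ℂ θ)
    (g : Field.absoluteGaloisGroup k₁) (hg : g ∈ (IntermediateField.adjoin k₁ {xθ}).fixingSubgroup) :
    ∃ s₁ : ℂ ≃ₐ[k₁] ℂ, (∀ x, s₁ (e₁ x) = e₁ (Field.absoluteGaloisGroup.toAlgEquiv k₁ g x)) ∧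
      ∀ a : k, s₁ (algebraMap k ℂ a) = algebraMap k ℂ a := by
  obtain ⟨s₁, hs₁⟩ := exists_algEquiv_apply_embedding_eq e₁ g
  refine ⟨s₁, hs₁, ringEquiv_apply_algebraMap_of_adjoin_eq_top hθ s₁.toRingEquiv ?_⟩
  have hfix : Field.absoluteGaloisGroup.toAlgEquiv k₁ g xθ = xθ :=
    (IntermediateField.mem_fixingSubgroup_iff _ _).1 hg xθ (IntermediateField.mem_adjoin_simple_self k₁ xθ)
  change s₁ (algebraMap k ℂ θ) = _
  rw [← hxθ, hs₁, hfix]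

/-- **An open subgroup of `Gal(k̄₁/E₀)` contains a finite level.**  For a finite extension `E₀ ⊆ k̄₁` of
`k₁` and an open subgroup `U` of `Gal(k̄₁/E₀)` there is a finite extension `E' ⊇ E₀` of `k₁` inside `k̄₁`
with `Gal(k̄₁/E') ⊆ U` (the Krull topology has the fixing subgroups of finite extensions as a basis of
neighbourhoods of `1`). [cite: Neukirch2013, Ch. IV §1 (Krull topology: the Gal(Ω/E), [E:k] < ∞, form a basis of neighbourhoods of 1)] -/
theorem exists_intermediateField_fixingSubgroup_subset {k₁ : Type} [Field k₁]
    (E₀ : IntermediateField k₁ (AlgebraicClosure k₁)) [FiniteDimensional k₁ E₀]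
    (U : Subgroup ↥E₀.fixingSubgroup) (hU : IsOpen (U : Set ↥E₀.fixingSubgroup)) :
    ∃ E' : IntermediateField k₁ (AlgebraicClosure k₁), FiniteDimensional k₁ E' ∧ E₀ ≤ E' ∧
      ∀ g : Field.absoluteGaloisGroup k₁, g ∈ E'.fixingSubgroup → ∃ hg : g ∈ E₀.fixingSubgroup,
        (⟨g, hg⟩ : ↥E₀.fixingSubgroup) ∈ U := by
  have hHopen : IsOpen (E₀.fixingSubgroup : Set (AlgebraicClosure k₁ ≃ₐ[k₁] AlgebraicClosure k₁)) :=
    IntermediateField.fixingSubgroup_isOpen E₀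
  let U' : Set (AlgebraicClosure k₁ ≃ₐ[k₁] AlgebraicClosure k₁) :=
    Subtype.val '' (U : Set ↥E₀.fixingSubgroup)
  have hU'o : IsOpen U' := hHopen.isOpenMap_subtype_val _ hU
  have h1U' : (1 : AlgebraicClosure k₁ ≃ₐ[k₁] AlgebraicClosure k₁) ∈ U' := ⟨1, U.one_mem, rfl⟩
  obtain ⟨E, hEfd, hEU⟩ :=
    (krullTopology_mem_nhds_one_iff k₁ (AlgebraicClosure k₁) U').1 (hU'o.mem_nhds h1U')
  haveI := hEfd
  refine ⟨E ⊔ E₀, IntermediateField.finiteDimensional_sup E E₀, le_sup_right, fun g hg => ?_⟩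
  have hgE : g ∈ E.fixingSubgroup := IntermediateField.fixingSubgroup_antitone le_sup_left hg
  have hgH : g ∈ E₀.fixingSubgroup := IntermediateField.fixingSubgroup_antitone le_sup_right hg
  obtain ⟨g', hg'U, hg'g⟩ := hEU hgE
  refine ⟨hgH, ?_⟩
  have hg' : g' = ⟨g, hgH⟩ := Subtype.ext hg'g
  exact hg' ▸ hg'U

/-- **The finite Galois level `k₂`.**  For number fields `k, k₁ ⊂ ℂ`, a `k₁`-embedding `e₁ : k̄₁ → ℂ` and a
finite extension `E' ⊆ k̄₁` of `k₁` there is a finite Galois extension `k₂ ⊆ ℂ` of `k` (again a number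
field) containing `k₁` and `e₁(E')`: the normal closure over `k` of `k(θ₁, e₁(B))`, `θ₁` a primitive
element of `k₁/ℚ` and `B` a `k₁`-basis of `E'` (all algebraic, so the normal closure inside `ℂ` is
normal; separable in characteristic `0`). [cite: Lang2002, Ch. V §3 (normal extensions, normal closure) and Ch. VI §1 (finite Galois extensions); Ch. V §4 Thm. 4.6] [cite: Shimura1998, §21.4, proof of Thm. 21.4, pp. 147–148 («a finite Galois extension k₂ of k containing k₁»)] -/
theorem exists_intermediateField_isGalois_forall_mem {k : Type} [Field k] [NumberField k] [Algebra k ℂ]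
    {k₁ : Type} [Field k₁] [NumberField k₁] [Algebra k₁ ℂ] (e₁ : AlgebraicClosure k₁ →ₐ[k₁] ℂ)
    (E' : IntermediateField k₁ (AlgebraicClosure k₁)) [FiniteDimensional k₁ E'] :
    ∃ k₂ : IntermediateField k ℂ, FiniteDimensional k k₂ ∧ IsGalois k k₂ ∧ NumberField k₂ ∧
      (∀ a : k₁, algebraMap k₁ ℂ a ∈ k₂) ∧ ∀ x : AlgebraicClosure k₁, x ∈ E' → e₁ x ∈ k₂ := by
  classical
  obtain ⟨θ₁, hθ₁⟩ := Field.exists_primitive_element ℚ k₁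
  let Bs := Module.finBasis k₁ ↥E'
  let gen : Set ℂ := insert (algebraMap k₁ ℂ θ₁) (Set.range fun i => e₁ (Bs i : AlgebraicClosure k₁))
  have hgen_int : ∀ z ∈ gen, IsIntegral k z := by
    rintro z (rfl | ⟨i, rfl⟩)
    · exact (((Algebra.IsAlgebraic.isAlgebraic (R := ℚ) θ₁).algebraMap (A := ℂ)).tower_top (L := k)).isIntegral
    · exact ((isAlgebraic_apply e₁ _).tower_top (L := k)).isIntegral
  let k₂₀ : IntermediateField k ℂ := IntermediateField.adjoin k gen
  haveI hk₂₀fd : FiniteDimensional k k₂₀ := IntermediateField.finiteDimensional_adjoin hgen_int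
  let k₂ : IntermediateField k ℂ := IntermediateField.normalClosure k ↥k₂₀ ℂ
  haveI hk₂fd : FiniteDimensional k k₂ := normalClosure.is_finiteDimensional k ↥k₂₀ ℂ
  have hnc : IsNormalClosure k ↥k₂₀ ↥k₂ :=
    Algebra.IsAlgebraic.isNormalClosure_normalClosure (fun x => IsAlgClosed.splits _)
  haveI : Normal k k₂ := hnc.normal
  haveI : IsGalois k k₂ := IsGalois.mk
  have instNF₂ : NumberField ↥k₂ :=
    { to_charZero := inferInstance, to_finiteDimensional := Module.Finite.trans k ↥k₂ }
  have hk₂₀le : k₂₀ ≤ k₂ := IntermediateField.le_normalClosure k₂₀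
  have hgen_mem : ∀ z ∈ gen, z ∈ k₂ := fun z hz => hk₂₀le (IntermediateField.subset_adjoin k gen hz)
  -- `k₁ = ℚ[θ₁] ⊆ k₂`
  have hk₁k₂ : ∀ a : k₁, algebraMap k₁ ℂ a ∈ k₂ := by
    intro a
    let S' : Subalgebra ℚ k₁ := (k₂.toSubalgebra.restrictScalars ℚ).comap (algebraMap k₁ ℂ).toRatAlgHom
    have hθ₁S : θ₁ ∈ S' := hgen_mem _ (Set.mem_insert _ _)
    have htop : Algebra.adjoin ℚ {θ₁} = ⊤ := by
      rw [← IntermediateField.adjoin_simple_toSubalgebra_of_isAlgebraic (Algebra.IsAlgebraic.isAlgebraic θ₁), hθ₁,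
        IntermediateField.top_toSubalgebra]
    have hle : Algebra.adjoin ℚ {θ₁} ≤ S' := Algebra.adjoin_le (Set.singleton_subset_iff.2 hθ₁S)
    have ha : a ∈ S' := hle (htop ▸ Algebra.mem_top)
    exact ha
  refine ⟨k₂, hk₂fd, inferInstance, instNF₂, hk₁k₂, fun x hx => ?_⟩
  -- `e₁(E') ⊆ k₂`: expand in the basis
  let φ : ↥E' →ₐ[k₁] ℂ := e₁.comp E'.val
  have hφ : φ ⟨x, hx⟩ = e₁ x := rfl
  rw [← hφ, ← Bs.sum_repr ⟨x, hx⟩, map_sum]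
  refine sum_mem fun i _ => ?_
  rw [Algebra.smul_def, map_mul, AlgHom.commutes]
  exact mul_mem (hk₁k₂ _) (hgen_mem _ (Set.mem_insert_of_mem _ ⟨i, rfl⟩))

/-- Two `F`-algebra structures on `k` through which a fixed map `f : F → L` factors along an injective
`k → L` coincide (used for the uniqueness of the `K* ⊆ k` structure inside `ℂ`). [cite: Lang2002, Ch. V §1 (embeddings; an injective k → L identifies the intermediate structures)] -/
theorem algebra_ext_of_algebraMap_eq {F k L : Type*} [CommSemiring F] [CommSemiring k]
    [CommSemiring L] [Algebra k L] (f : F →+* L) (hinj : Function.Injective (algebraMap k L))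
    (I J : Algebra F k) (hI : ∀ r, algebraMap k L (haveI := I; algebraMap F k r) = f r)
    (hJ : ∀ r, algebraMap k L (haveI := J; algebraMap F k r) = f r) : I = J :=
  Algebra.algebra_ext _ _ fun r => hinj ((hI r).trans (hJ r).symm)

/-- **The structure `F ⊆ k` inside `ℂ` exists and is unique** when `F ⊆ ℂ` lies in the image of `k`:
there is an `F`-algebra structure on `k` compatible with the embeddings into `ℂ`.
[cite: Lang2002, Ch. V §1 (embeddings of subfields)] -/
theorem exists_algebra_isScalarTower_of_subset_range {k : Type} [Field k] [Algebra k ℂ]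
    (F : IntermediateField ℚ ℂ) (hF : (F : Set ℂ) ⊆ Set.range (algebraMap k ℂ)) :
    ∃ _ : Algebra ↥F k, IsScalarTower ↥F k ℂ := by
  have hinjk : Function.Injective (algebraMap k ℂ) := (algebraMap k ℂ).injective
  let ψ : ↥F →+* k :=
    { toFun := fun z => Classical.choose (hF z.2)
      map_one' := hinjk (by rw [Classical.choose_spec (hF (1 : ↥F).2), map_one]; rfl)
      map_mul' := fun a c => hinjk (by
        rw [map_mul, Classical.choose_spec (hF (a * c).2), Classical.choose_spec (hF a.2),
          Classical.choose_spec (hF c.2)]; rfl)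
      map_zero' := hinjk (by rw [Classical.choose_spec (hF (0 : ↥F).2), map_zero]; rfl)
      map_add' := fun a c => hinjk (by
        rw [map_add, Classical.choose_spec (hF (a + c).2), Classical.choose_spec (hF a.2),
          Classical.choose_spec (hF c.2)]; rfl) }
  have hψ : ∀ z : ↥F, algebraMap k ℂ (ψ z) = (z : ℂ) := fun z => Classical.choose_spec (hF z.2)
  letI instAlg : Algebra ↥F k := ψ.toAlgebra
  exact ⟨instAlg, IsScalarTower.of_algebraMap_eq fun z => (hψ z).symm⟩

end Literature.FieldTheory.AlgClosed

end
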